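import Summits.BirchSwinnertonDyer.BirchSwinnertonDyer.Theorems.Rank2ObservatoryRank3CensusJoins112
import HarnessLib

/-!
# BirchSwinnertonDyer — rank ≥ 2 observatory: rank-3 census HEADLINES at 9 375 (distinct curves, analytic mirror, one-stop rows)

HONEST FRAMING: per-curve certified theorems and census instruments; no claim on BSD in rank ≥ 2.

Companion of `Rank2ObservatoryRank3CensusJoins112` (the saturation / generators joins re-keyed on
the rank).  The landed headlines `exists_distinct_curves_rank_three` (`Rank2ObservatoryRank3CensusCurves`)
and `exists_distinct_curves_analyticRank_three` (`Rank2ObservatoryRank3CensusAnalytic`) count the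
9 365 rows of `Rank3KernelRankCensusN9365`, and their whole-table forms ask the 2-descent bound
`hup : rank_ℤ ≤ 3` of the 122 rows of `Rank3CensusAudit.residualRows`.  The rank census is now
`Rank3KernelRankCensusN9375` (9 375 rows, `rank_ℤ = 3` hypothesis-free) with residual register
`Rank3CensusAudit.residualRows112` (112 rows).  THIS FILE re-pins the headlines at that granularity
(pure glue BY NAME; no definitions, no data, no `decide` on tables):
* §1 `rows9375_curves_nodup`; `exists_distinct_curves_rank_three_9375` — a duplicate-free list of
  **9 375 elliptic curves over `ℚ` of conductor `< 5·10⁵`, each with `rank_ℤ E(ℚ) = 3`, NO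
  hypothesis**; `exists_distinct_rows_rank_three_index_9375` — the same 9 375 rows WITH their three
  listed points spanning, with the torsion, a subgroup of finite index prime to `210` (no hypothesis);
  `exists_distinct_curves_rank_three_table112` — all 9 487, `hup` for the 112 residual rows only;
* §2 the analytic mirror: `analyticRank_eq_three_of_mem_rank3Table112_w` (`r_an = rank_ℤ = 3` for a
  table row from `hGZK` = Gross–Zagier–Kolyvagin, the named local-root-number facts `hKD`/`hR`, the
  numerical `L‴(E,1) ≠ 0`, and `hup` only if the row is one of the 112),
  `analyticRank_eq_three_w_of_mem_rows9375` (no rank / sign hypothesis over N9375),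
  `exists_distinct_curves_analyticRank_three_9375` (was 9 365) and `…_table112` (9 487, `hup` for 112);
* §3 ONE-STOP row packages `algebraicDataRankSat_of_mem_rows9375` / `…_table112`: minimal model ∧
  `N_E = N < 5·10⁵` ∧ `rank_ℤ E(ℚ) = 3` ∧ listed span of finite index prime to `210`.
Sorry-free; no new axioms.

References: J. W. S. Cassels, *Lectures on Elliptic Curves* (1991) §15; J. E. Cremona, *Algorithms
for Modular Elliptic Curves* (2nd ed. 1997) §2.13, §3.5, Tables; H. Darmon, *Rational Points on
Modular Elliptic Curves* (2004) Thm. 3.22; O. Rizzo, Compos. Math. 136 (2003) §1; J. H. Silverman,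
*Advanced Topics in the Arithmetic of Elliptic Curves* (1994) IV.9.4.
-/

-- single-conjunct summit: `Summit.BirchSwinnertonDyer.BirchSwinnertonDyer.…` repeats the name by design
set_option linter.dupNamespace false

namespace Summit.BirchSwinnertonDyer.BirchSwinnertonDyer.Rank2Observatory

open Literature Literature.NumberTheory.EllipticCurves WeierstrassCurve

namespace Rank3Joins112

open Rank3CensusAudit (residualRows112 rank_eq_three_of_mem_rank3Table112 mem_rows9375_iff
  rows9375_nodup residualRows112_subset_rank3Table)

/-! ### §1 Headlines at 9 375: distinct curves -/

/-- **The 9 375 rows of GRAND census N9375 are 9 375 pairwise distinct curves.**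
[cite: CremonaAlgorithms1997, Tables] -/
theorem rows9375_curves_nodup : (Rank3KernelRankCensusN9375.rows.map Rank3Row.curve).Nodup :=
  List.Nodup.map_on (fun r hr s hs h => rank3Table_curve_injOn r (mem_rows9375_iff.1 hr).1 s
    (mem_rows9375_iff.1 hs).1 h) rows9375_nodup

/-- **HEADLINE.** There is a duplicate-free list of **9 375 elliptic curves over `ℚ` of conductor
`< 500 000`, each with Mordell–Weil rank EXACTLY 3**, proved with NO hypothesis (kernel-checked
2-descent / isogeny-descent upper bounds and three independent points per curve; the list is
`Rank3KernelRankCensusN9375.rows.map Rank3Row.curve`; supersedes the 9 365 of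
`exists_distinct_curves_rank_three`). [cite: Cassels1991LecturesEllipticCurves, §15]
[cite: CremonaAlgorithms1997, Tables, §3.5, §3.6] -/
theorem exists_distinct_curves_rank_three_9375 :
    ∃ l : List (WeierstrassCurve ℚ), l.Nodup ∧ l.length = 9375 ∧
      ∀ E ∈ l, E.IsElliptic ∧ E.conductorNorm ℤ < 500000 ∧ E.mordellWeilRank = 3 := by
  refine ⟨Rank3KernelRankCensusN9375.rows.map Rank3Row.curve, rows9375_curves_nodup,
    by rw [List.length_map, Rank3KernelRankCensusN9375.rows_length], ?_⟩
  intro E hE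
  obtain ⟨r, hr, rfl⟩ := List.mem_map.1 hE
  have hrt : r ∈ rank3Table := Rank3KernelRankCensusN9375.mem_rank3Table r hr
  exact ⟨isElliptic_of_mem hrt, Rank3Row.conductorNorm_lt_of_mem hrt,
    Rank3KernelRankCensusN9375.rank_eq_three r hr⟩

/-- **HEADLINE with the listed generators.** 9 375 pairwise distinct elliptic curves over `ℚ` of
conductor `< 500 000` with `rank_ℤ E(ℚ) = 3` AND three listed points spanning with the torsion a
subgroup of finite index prime to `210` — NO hypothesis. [cite: CremonaAlgorithms1997, Tables, §3.5]
[cite: Cassels1991LecturesEllipticCurves, §15] -/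
theorem exists_distinct_rows_rank_three_index_9375 :
    ∃ l : List Rank3Row, (l.map Rank3Row.curve).Nodup ∧ l.length = 9375 ∧
      ∀ r ∈ l, r.curve.IsElliptic ∧ r.curve.conductorNorm ℤ < 500000 ∧ r.curve.mordellWeilRank = 3 ∧
        ∃ h : r.check = true,
          (AddSubgroup.closure {r.gen₁ h, r.gen₂ h, r.gen₃ h} ⊔ AddCommGroup.torsion _).FiniteIndex ∧
          ∀ p : ℕ, p.Prime →
            p ∣ (AddSubgroup.closure {r.gen₁ h, r.gen₂ h, r.gen₃ h} ⊔ AddCommGroup.torsion _).index →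
              11 ≤ p := by
  refine ⟨Rank3KernelRankCensusN9375.rows, rows9375_curves_nodup,
    Rank3KernelRankCensusN9375.rows_length, ?_⟩
  intro r hr
  have hrt : r ∈ rank3Table := Rank3KernelRankCensusN9375.mem_rank3Table r hr
  exact ⟨isElliptic_of_mem hrt, Rank3Row.conductorNorm_lt_of_mem hrt,
    Rank3KernelRankCensusN9375.rank_eq_three r hr, check_of_mem hrt,
    index_coprime_210_of_mem_rows9375' hr⟩

/-- **HEADLINE, whole table.** Granting the 2-descent bound `rank_ℤ ≤ 3` for the 112 residual
curves ONLY, the 9 487 curves of the census table are 9 487 pairwise distinct elliptic curves of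
conductor `< 500 000` with `rank_ℤ E(ℚ) = 3` (supersedes `exists_distinct_curves_rank_three_table`,
which asks it of 122). [cite: Cassels1991LecturesEllipticCurves, §15]
[cite: CremonaAlgorithms1997, Tables, §3.5, §3.6] -/
theorem exists_distinct_curves_rank_three_table112
    (hup : ∀ r ∈ residualRows112, r.curve.mordellWeilRank ≤ 3) :
    ∃ l : List (WeierstrassCurve ℚ), l.Nodup ∧ l.length = 9487 ∧
      ∀ E ∈ l, E.IsElliptic ∧ E.conductorNorm ℤ < 500000 ∧ E.mordellWeilRank = 3 := by
  refine ⟨rank3Table.map Rank3Row.curve, rank3Table_curves_nodup,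
    by rw [List.length_map, rank3Table_length], ?_⟩
  intro E hE
  obtain ⟨r, hr, rfl⟩ := List.mem_map.1 hE
  exact ⟨isElliptic_of_mem hr, Rank3Row.conductorNorm_lt_of_mem hr,
    rank_eq_three_of_mem_rank3Table112 hr (hup r)⟩

/-! ### §2 The analytic mirror -/

/-- **`r_an(E) = rank_ℤ E(ℚ) = 3` over the WHOLE rank-3 table with `hlow`, `hup` (outside the 112
residual rows) and `w(E) = −1` discharged by the kernel**: remaining inputs `hGZK`, the named
local-root-number facts `hKD`, `hR`, the numerical `L‴(E,1) ≠ 0`, and `rank_ℤ ≤ 3` for the 112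
residual rows only (was: 122). [cite: Darmon2004, Thm. 3.22]
[cite: Rizzo2003, §1 Fact 3 and Table II (p. 4)] [cite: KellockDokchitser2023, Thm. 2.3 and §5] -/
theorem analyticRank_eq_three_of_mem_rank3Table112_w
    (hGZK : rank_eq_analyticRank_of_analyticRank_le_one) {r : Rank3Row} (hr : r ∈ rank3Table)
    (hup : r ∈ residualRows112 → r.curve.mordellWeilRank ≤ 3)
    (hL3 : iteratedDeriv 3 r.curve.entireLFunction 1 ≠ 0)
    (hKD : r.curve.rootNumber_eq_neg_finprod_tableLocalRootNumberAt')
    (hR : r.curve.rootNumber_eq_neg_finprod_fullTableLocalRootNumberAt) :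
    r.curve.analyticRank = r.curve.mordellWeilRank ∧ r.curve.analyticRank = 3 := by
  have hrk := rank_eq_three_of_mem_rank3Table112 hr hup
  have h := Rank3Row.analyticRank_eq_rank_of_three_le hr hrk.ge hGZK hrk.le hL3
    (Rank3Row.rootNumber_eq_neg_one_of_mem hr hKD hR)
  exact ⟨h, h.trans hrk⟩

/-- **GRAND-census N9375 form**: over the 9 375 rows, `r_an(E) = rank_ℤ E(ℚ) = 3` from `hGZK`,
`hKD`, `hR` and the numerical `L‴(E,1) ≠ 0` alone — no rank and no sign hypothesis (upgrade of
`Rank3KernelRankCensusN9375.analyticRank_eq_three`, whose `w(E) = −1` input is now the kernel's, and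
of `Rank3KernelRankCensusN9365.analyticRank_eq_three_w`, 9 365 rows). [cite: Darmon2004, Thm. 3.22]
[cite: KellockDokchitser2023, Thm. 2.3 and §5] -/
theorem analyticRank_eq_three_w_of_mem_rows9375 (hGZK : rank_eq_analyticRank_of_analyticRank_le_one) :
    ∀ r ∈ Rank3KernelRankCensusN9375.rows, iteratedDeriv 3 r.curve.entireLFunction 1 ≠ 0 →
      r.curve.rootNumber_eq_neg_finprod_tableLocalRootNumberAt' →
      r.curve.rootNumber_eq_neg_finprod_fullTableLocalRootNumberAt →
      r.curve.analyticRank = r.curve.mordellWeilRank ∧ r.curve.analyticRank = 3 :=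
  fun _ hr hL3 hKD hR =>
    analyticRank_eq_three_of_mem_rank3Table112_w hGZK (mem_rows9375_iff.1 hr).1
      (fun h => absurd h (mem_rows9375_iff.1 hr).2) hL3 hKD hR

/-- **HEADLINE (analytic side) at 9 375.** Granting Gross–Zagier–Kolyvagin, the named
local-root-number facts for the curves of the table, and the engine-side numerical input
`L‴(E,1) ≠ 0` for the rows of the table, there are 9 375 pairwise DISTINCT elliptic curves over `ℚ`
of conductor `< 5·10⁵` with `r_an(E) = 3` AND `rank_ℤ E(ℚ) = 3` — the rank a hypothesis-free kernel
theorem, the analytic rank a per-curve conditional one (was 9 365). [cite: Darmon2004, Thm. 3.22]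
[cite: Cassels1991LecturesEllipticCurves, §15] [cite: CremonaAlgorithms1997, §2.13 and Tables] -/
theorem exists_distinct_curves_analyticRank_three_9375
    (hGZK : rank_eq_analyticRank_of_analyticRank_le_one)
    (hKD : ∀ r ∈ rank3Table, r.curve.rootNumber_eq_neg_finprod_tableLocalRootNumberAt')
    (hR : ∀ r ∈ rank3Table, r.curve.rootNumber_eq_neg_finprod_fullTableLocalRootNumberAt)
    (hL3 : ∀ r ∈ rank3Table, iteratedDeriv 3 r.curve.entireLFunction 1 ≠ 0) :
    ∃ l : List (WeierstrassCurve ℚ), l.Nodup ∧ l.length = 9375 ∧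
      ∀ E ∈ l, E.IsElliptic ∧ E.conductorNorm ℤ < 500000 ∧ E.analyticRank = 3 ∧
        E.mordellWeilRank = 3 := by
  refine ⟨Rank3KernelRankCensusN9375.rows.map Rank3Row.curve, rows9375_curves_nodup,
    by rw [List.length_map, Rank3KernelRankCensusN9375.rows_length], ?_⟩
  intro E hE
  obtain ⟨r, hr, rfl⟩ := List.mem_map.1 hE
  have ht : r ∈ rank3Table := Rank3KernelRankCensusN9375.mem_rank3Table r hr
  have h := analyticRank_eq_three_w_of_mem_rows9375 hGZK r hr (hL3 r ht) (hKD r ht) (hR r ht)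
  exact ⟨isElliptic_of_mem ht, Rank3Row.conductorNorm_lt_of_mem ht, h.2, h.1.symm.trans h.2⟩

/-- **HEADLINE, analytic side, whole table with `hup` for the 112 only**: 9 487 pairwise distinct
elliptic curves of conductor `< 500 000` with `r_an(E) = rank_ℤ E(ℚ) = 3`, granting `hGZK`, `hKD`,
`hR`, `L‴(E,1) ≠ 0` per row, and `rank_ℤ ≤ 3` for the 112 residual rows.
[cite: Darmon2004, Thm. 3.22] [cite: CremonaAlgorithms1997, §2.13 and Tables] -/
theorem exists_distinct_curves_analyticRank_three_table112
    (hGZK : rank_eq_analyticRank_of_analyticRank_le_one)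
    (hKD : ∀ r ∈ rank3Table, r.curve.rootNumber_eq_neg_finprod_tableLocalRootNumberAt')
    (hR : ∀ r ∈ rank3Table, r.curve.rootNumber_eq_neg_finprod_fullTableLocalRootNumberAt)
    (hL3 : ∀ r ∈ rank3Table, iteratedDeriv 3 r.curve.entireLFunction 1 ≠ 0)
    (hup : ∀ r ∈ residualRows112, r.curve.mordellWeilRank ≤ 3) :
    ∃ l : List (WeierstrassCurve ℚ), l.Nodup ∧ l.length = 9487 ∧
      ∀ E ∈ l, E.IsElliptic ∧ E.conductorNorm ℤ < 500000 ∧ E.analyticRank = 3 ∧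
        E.mordellWeilRank = 3 := by
  refine ⟨rank3Table.map Rank3Row.curve, rank3Table_curves_nodup,
    by rw [List.length_map, rank3Table_length], ?_⟩
  intro E hE
  obtain ⟨r, hr, rfl⟩ := List.mem_map.1 hE
  have h := analyticRank_eq_three_of_mem_rank3Table112_w hGZK hr (hup r) (hL3 r hr) (hKD r hr) (hR r hr)
  exact ⟨isElliptic_of_mem hr, Rank3Row.conductorNorm_lt_of_mem hr, h.2, h.1.symm.trans h.2⟩

/-! ### §3 One-stop row packages -/

/-- **ONE-STOP ALGEBRAIC DATA + SATURATION for a row of GRAND census N9375, NO hypothesis**: global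
minimality, `N_E = N < 500 000`, `rank_ℤ E(ℚ) = 3`, and the listed span of finite index prime to
`210`. [cite: Silverman1994, IV.9.4] [cite: Cassels1991LecturesEllipticCurves, §15]
[cite: CremonaAlgorithms1997, Tables, §3.5, §3.6] -/
theorem algebraicDataRankSat_of_mem_rows9375 {r : Rank3Row}
    (hr : r ∈ Rank3KernelRankCensusN9375.rows) :
    r.curve.IsGloballyMinimal ∧ r.curve.conductorNorm ℤ = r.N ∧ r.N < 500000 ∧
      r.curve.mordellWeilRank = 3 ∧
      ∀ h : r.check = true,
        (AddSubgroup.closure {r.gen₁ h, r.gen₂ h, r.gen₃ h} ⊔ AddCommGroup.torsion _).FiniteIndex ∧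
        ¬ 2 ∣ (AddSubgroup.closure {r.gen₁ h, r.gen₂ h, r.gen₃ h} ⊔ AddCommGroup.torsion _).index ∧
        ¬ 3 ∣ (AddSubgroup.closure {r.gen₁ h, r.gen₂ h, r.gen₃ h} ⊔ AddCommGroup.torsion _).index ∧
        ¬ 5 ∣ (AddSubgroup.closure {r.gen₁ h, r.gen₂ h, r.gen₃ h} ⊔ AddCommGroup.torsion _).index ∧
        ¬ 7 ∣ (AddSubgroup.closure {r.gen₁ h, r.gen₂ h, r.gen₃ h} ⊔ AddCommGroup.torsion _).index :=
  have hrt := Rank3KernelRankCensusN9375.mem_rank3Table r hr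
  have hrk := Rank3KernelRankCensusN9375.rank_eq_three r hr
  ⟨Rank3Row.isGloballyMinimal_of_mem hrt, Rank3Row.conductorNorm_eq_of_mem hrt, N_lt_of_mem hrt, hrk,
    fun h => index_coprime_210_of_rank hrt h hrk⟩

/-- **ONE-STOP, whole table**: the same for EVERY row of the rank-3 table, `hup : rank_ℤ ≤ 3` asked
only of the 112 residual rows. [cite: Silverman1994, IV.9.4] [cite: Cassels1991LecturesEllipticCurves, §15]
[cite: CremonaAlgorithms1997, Tables, §3.5, §3.6] -/
theorem algebraicDataRankSat_table112 {r : Rank3Row} (hr : r ∈ rank3Table)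
    (hup : r ∈ residualRows112 → r.curve.mordellWeilRank ≤ 3) :
    r.curve.IsGloballyMinimal ∧ r.curve.conductorNorm ℤ = r.N ∧ r.N < 500000 ∧
      r.curve.mordellWeilRank = 3 ∧
      ∀ h : r.check = true,
        (AddSubgroup.closure {r.gen₁ h, r.gen₂ h, r.gen₃ h} ⊔ AddCommGroup.torsion _).FiniteIndex ∧
        ¬ 2 ∣ (AddSubgroup.closure {r.gen₁ h, r.gen₂ h, r.gen₃ h} ⊔ AddCommGroup.torsion _).index ∧
        ¬ 3 ∣ (AddSubgroup.closure {r.gen₁ h, r.gen₂ h, r.gen₃ h} ⊔ AddCommGroup.torsion _).index ∧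
        ¬ 5 ∣ (AddSubgroup.closure {r.gen₁ h, r.gen₂ h, r.gen₃ h} ⊔ AddCommGroup.torsion _).index ∧
        ¬ 7 ∣ (AddSubgroup.closure {r.gen₁ h, r.gen₂ h, r.gen₃ h} ⊔ AddCommGroup.torsion _).index :=
  have hrk := rank_eq_three_of_mem_rank3Table112 hr hup
  ⟨Rank3Row.isGloballyMinimal_of_mem hr, Rank3Row.conductorNorm_eq_of_mem hr, N_lt_of_mem hr, hrk,
    fun h => index_coprime_210_of_rank hr h hrk⟩

end Rank3Joins112

end Summit.BirchSwinnertonDyer.BirchSwinnertonDyer.Rank2Observatory
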